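import Mathlib

/-!
# Two counting lemmas for the `U = 0` calibration of `PerWidthThermodynamics`
# (stmt-HubbardSuperconductivity-18510): open shells of a finite band, and even floors

Generic inputs of `ZeroCouplingCompressibility.lean` (the fixed-width free tube has vanishing pair
compressibility cofinally in `L`), kept apart because they mention no physics:

* `exists_openShell_of_card_ne` — for levels `ε : ι → ℝ` on a finite index type and a particle number
  `0 < n ≤ #ι` which is NOT a cumulative shell count (`#{ε ≤ μ} ≠ n` for every `μ`), the `n`-th level
  is strictly inside a shell: `#{ε < μ} < n < #{ε ≤ μ}` for some `μ` (the least band value `μ` with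
  `n ≤ #{ε ≤ μ}`); the abstract form of `exists_openShell_of_even` of
  `WidthUniformThermodynamics/Negative/WidthUniformThermodynamicsFreeOpenShell.lean`;
* `exists_ge_even_floor` — for every real `β ≥ 0` the integer parts `⌊β l⌋`, `l ∈ ℕ`, are even for
  infinitely many `l` (if they were odd from `l₀` on, consecutive differences would be even integers
  in `(β - 1, β + 1)`, hence constant `= d`, forcing `β = d` even and `⌊β l₀⌋ = d l₀` even).

Folklore; no definitions, no named facts. Mathlib: `Finset.min'`, `Nat.floor_le`,
`Nat.lt_floor_add_one`, `exists_nat_gt`.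
-/

noncomputable section

namespace Summit.HubbardSuperconductivity.HubbardSuperconductivity.Theorems.PerWidthThermodynamics.Negative

set_option linter.dupNamespace false -- summit = problem name (single-conjunct summit), D-0017

open Finset

/-! ### Open shells of a finite band (generic) -/

section OpenShell

/-- **A particle number that is not a cumulative shell count sits strictly inside a shell.** For
levels `ε` on a finite index type and `0 < n ≤ #ι` with `#{ε ≤ μ} ≠ n` for all `μ`, there is a level `μ`
with `#{ε < μ} < n < #{ε ≤ μ}` (take the least band value `μ` with `n ≤ #{ε ≤ μ}`). [folklore] -/
theorem exists_openShell_of_card_ne {ι : Type*} [Fintype ι] (ε : ι → ℝ) {n : ℕ} (hn0 : 0 < n)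
    (hn : n ≤ Fintype.card ι) (hne : ∀ μ : ℝ, (univ.filter fun k : ι => ε k ≤ μ).card ≠ n) :
    ∃ μ : ℝ, (univ.filter fun k : ι => ε k < μ).card < n ∧ n < (univ.filter fun k : ι => ε k ≤ μ).card := by
  have hι : Nonempty ι := Fintype.card_pos_iff.1 (hn0.trans_le hn)
  obtain ⟨k0⟩ := hι
  -- admissible values: band values `v` with `n ≤ #{ε ≤ v}`
  set V : Finset ℝ := (univ.image ε).filter fun v => n ≤ (univ.filter fun k : ι => ε k ≤ v).card with hV
  have hVne : V.Nonempty := by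
    refine ⟨(univ.image ε).max' ⟨_, mem_image_of_mem _ (mem_univ k0)⟩, ?_⟩
    rw [hV, mem_filter]
    refine ⟨Finset.max'_mem _ _, ?_⟩
    have hall : (univ.filter fun k : ι => ε k ≤ (univ.image ε).max' ⟨_, mem_image_of_mem _ (mem_univ k0)⟩) = univ :=
      Finset.filter_true_of_mem fun k _ => Finset.le_max' _ _ (mem_image_of_mem _ (mem_univ k))
    rw [hall, Finset.card_univ]
    exact hn
  set μ : ℝ := V.min' hVne with hμ
  have hμV : μ ∈ V := Finset.min'_mem _ _
  rw [hV, mem_filter, mem_image] at hμV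
  obtain ⟨⟨k₀, -, hk₀⟩, hnle⟩ := hμV
  refine ⟨μ, ?_, lt_of_le_of_ne hnle (fun heq => hne μ heq.symm)⟩
  by_contra hlt
  push Not at hlt
  have hne' : (univ.filter fun k : ι => ε k < μ).Nonempty := by
    rw [← Finset.card_pos]; omega
  set v' : ℝ := ((univ.filter fun k : ι => ε k < μ).image ε).max' (hne'.image _) with hv'
  have hv'mem := Finset.max'_mem _ (hne'.image ε)
  rw [← hv', mem_image] at hv'mem
  obtain ⟨k₁, hk₁, hk₁v⟩ := hv'mem
  have hv'lt : v' < μ := by rw [← hk₁v]; exact (mem_filter.1 hk₁).2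
  have hsub : (univ.filter fun k : ι => ε k < μ) ⊆ (univ.filter fun k : ι => ε k ≤ v') := by
    intro k hk
    rw [mem_filter] at hk ⊢
    exact ⟨hk.1, Finset.le_max' _ _ (mem_image_of_mem _ (mem_filter.2 hk))⟩
  have hv'V : v' ∈ V := by
    rw [hV, mem_filter]
    refine ⟨?_, hlt.trans (Finset.card_le_card hsub)⟩
    rw [← hk₁v]
    exact mem_image_of_mem _ (mem_univ k₁)
  have := Finset.min'_le V v' hv'V
  rw [← hμ] at this
  linarith

end OpenShell


/-! ### Even floors: `⌊β l⌋` is even for infinitely many `l` -/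

section EvenFloor

/-- **Even integer parts along an arithmetic ray.** For every real `β ≥ 0` and every `l₀` there is
`l ≥ l₀` with `⌊β l⌋` even: otherwise the consecutive differences `⌊β(l+1)⌋ - ⌊β l⌋`, `l ≥ l₀`, are even
integers in the open interval `(β - 1, β + 1)`, hence all equal to one even `d`; then
`⌊β(l₀ + j)⌋ = ⌊β l₀⌋ + j d` for all `j` forces `β = d`, and `⌊β l₀⌋ = d l₀` is even — contradiction.
[folklore] -/
theorem exists_ge_even_floor {β : ℝ} (hβ : 0 ≤ β) (l₀ : ℕ) : ∃ l : ℕ, l₀ ≤ l ∧ Even ⌊β * l⌋₊ := by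
  by_contra hcon
  push Not at hcon
  -- `a l = ⌊β l⌋`, odd for all `l ≥ l₀`
  set a : ℕ → ℕ := fun l => ⌊β * l⌋₊ with ha
  have hodd : ∀ l, l₀ ≤ l → Odd (a l) := fun l hl => Nat.not_even_iff_odd.1 (hcon l hl)
  have hfl : ∀ l : ℕ, (a l : ℝ) ≤ β * l ∧ β * l < a l + 1 := fun l =>
    ⟨Nat.floor_le (by positivity), Nat.lt_floor_add_one _⟩
  have hmono : ∀ l : ℕ, a l ≤ a (l + 1) := fun l =>
    Nat.floor_le_floor (by push_cast; nlinarith)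
  -- consecutive differences are even and lie in `(β - 1, β + 1)`
  have hdiff : ∀ l, l₀ ≤ l → Even (a (l + 1) - a l) ∧ β - 1 < ((a (l + 1) - a l : ℕ) : ℝ) ∧
      ((a (l + 1) - a l : ℕ) : ℝ) < β + 1 := by
    intro l hl
    refine ⟨?_, ?_, ?_⟩
    · exact Nat.Odd.sub_odd (hodd (l + 1) (Nat.le_succ_of_le hl)) (hodd l hl)
    · rw [Nat.cast_sub (hmono l)]
      have h1 := (hfl (l + 1)).2; have h2 := (hfl l).1
      push_cast at h1; linarith
    · rw [Nat.cast_sub (hmono l)]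
      have h1 := (hfl (l + 1)).1; have h2 := (hfl l).2
      push_cast at h1; linarith
  -- hence all differences equal `d := a (l₀+1) - a l₀`
  set d : ℕ := a (l₀ + 1) - a l₀ with hd
  have hdeq : ∀ l, l₀ ≤ l → a (l + 1) - a l = d := by
    intro l hl
    obtain ⟨he, hlo, hhi⟩ := hdiff l hl
    obtain ⟨he0, hlo0, hhi0⟩ := hdiff l₀ le_rfl
    -- two even naturals at distance `< 2` are equal
    obtain ⟨r, hr⟩ := he
    obtain ⟨r0, hr0⟩ := he0
    have h1 : ((a (l + 1) - a l : ℕ) : ℝ) < ((a (l₀ + 1) - a l₀ : ℕ) : ℝ) + 2 := by linarith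
    have h2 : ((a (l₀ + 1) - a l₀ : ℕ) : ℝ) < ((a (l + 1) - a l : ℕ) : ℝ) + 2 := by linarith
    rw [hr, hr0] at h1 h2
    have h1' : r + r < r0 + r0 + 2 := by exact_mod_cast h1
    have h2' : r0 + r0 < r + r + 2 := by exact_mod_cast h2
    rw [hr, hd, hr0]
    omega
  -- so `a (l₀ + j) = a l₀ + j d`
  have hlin : ∀ j : ℕ, a (l₀ + j) = a l₀ + j * d := by
    intro j
    induction j with
    | zero => simp
    | succ j ih =>
      have h := hdeq (l₀ + j) (Nat.le_add_right _ _)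
      have hm := hmono (l₀ + j)
      have hj : l₀ + (j + 1) = l₀ + j + 1 := by omega
      rw [hj, add_mul, one_mul]
      omega
  -- `|j (d - β)| < 1` for all `j`, hence `β = d`
  have hbd : ∀ j : ℕ, |(j : ℝ) * ((d : ℝ) - β)| < 1 := by
    intro j
    have h1 := (hfl (l₀ + j)).1
    have h2 := (hfl (l₀ + j)).2
    have h3 := (hfl l₀).1
    have h4 := (hfl l₀).2
    rw [hlin j] at h1 h2
    push_cast at h1 h2 h3 h4
    rw [abs_lt]
    constructor <;> nlinarith
  have hβd : β = d := by
    by_contra hne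
    have hpos : 0 < |(d : ℝ) - β| := abs_pos.2 (sub_ne_zero.2 (Ne.symm hne))
    obtain ⟨j, hj⟩ := exists_nat_gt (1 / |(d : ℝ) - β|)
    have h := hbd j
    rw [abs_mul, Nat.abs_cast] at h
    rw [div_lt_iff₀ hpos] at hj
    linarith
  -- `β = d` is an even natural (`d` is even), so `a l₀ = d l₀` is even: contradiction
  have hde : Even d := (hdiff l₀ le_rfl).1
  have ha0 : a l₀ = d * l₀ := by
    show ⌊β * l₀⌋₊ = d * l₀
    rw [hβd]; exact_mod_cast Nat.floor_natCast (d * l₀)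
  exact (Nat.not_even_iff_odd.2 (hodd l₀ le_rfl)) (ha0 ▸ hde.mul_right l₀)

end EvenFloor

/-! ### Odd integer parts along an arithmetic ray (appended 2026-08-17, session 7 of the
`SeamInduction` prover seat; consumer: `ZeroCouplingStiffness`) -/

section OddFloor

/-- **Odd integer parts along an arithmetic ray.** For `1 ≤ β < 2` and every `l₀` there is `l ≥ l₀`
with `⌊β l⌋` odd: otherwise all `⌊β l⌋`, `l ≥ l₀`, are even, consecutive ones differ by an even
number in `{1, 2}`, i.e. by `2`, so `⌊β(l₀ + j)⌋ = ⌊β l₀⌋ + 2j` for all `j` — impossible for `β < 2`.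
[folklore] -/
theorem exists_ge_odd_floor {β : ℝ} (hβ1 : 1 ≤ β) (hβ2 : β < 2) (l₀ : ℕ) :
    ∃ l : ℕ, l₀ ≤ l ∧ Odd ⌊β * l⌋₊ := by
  by_contra hcon
  push Not at hcon
  set a : ℕ → ℕ := fun l => ⌊β * l⌋₊ with ha
  have heven : ∀ l, l₀ ≤ l → Even (a l) := fun l hl => Nat.not_odd_iff_even.1 (hcon l hl)
  have hfl : ∀ l : ℕ, (a l : ℝ) ≤ β * l ∧ β * l < a l + 1 := fun l =>
    ⟨Nat.floor_le (by positivity), Nat.lt_floor_add_one _⟩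
  -- consecutive values differ by exactly `2`
  have hstep : ∀ l, l₀ ≤ l → a (l + 1) = a l + 2 := by
    intro l hl
    have h1 : a l + 1 ≤ a (l + 1) := by
      show ⌊β * l⌋₊ + 1 ≤ ⌊β * (l + 1 : ℕ)⌋₊
      rw [← Nat.floor_add_one (by positivity)]
      exact Nat.floor_le_floor (by push_cast; nlinarith)
    have h2 : a (l + 1) ≤ a l + 2 := by
      show ⌊β * (l + 1 : ℕ)⌋₊ ≤ ⌊β * l⌋₊ + 2
      rw [← Nat.floor_add_natCast (by positivity) 2]
      exact Nat.floor_le_floor (by push_cast; nlinarith)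
    obtain ⟨p, hp⟩ := heven l hl
    obtain ⟨q, hq⟩ := heven (l + 1) (Nat.le_succ_of_le hl)
    omega
  have hlin : ∀ j : ℕ, a (l₀ + j) = a l₀ + 2 * j := by
    intro j
    induction j with
    | zero => simp
    | succ j ih =>
      rw [show l₀ + (j + 1) = l₀ + j + 1 by omega, hstep (l₀ + j) (Nat.le_add_right _ _), ih]
      ring
  -- `(2 - β) j < 1` for all `j`: absurd
  have h2β : 0 < 2 - β := by linarith
  obtain ⟨j, hj⟩ := exists_nat_ge (1 / (2 - β))
  have h1 := (hfl (l₀ + j)).1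
  have h2 := (hfl l₀).2
  rw [hlin j] at h1
  push_cast at h1
  rw [div_le_iff₀ h2β] at hj
  nlinarith

end OddFloor

end Summit.HubbardSuperconductivity.HubbardSuperconductivity.Theorems.PerWidthThermodynamics.Negative

end
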